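import Summits.AtomisticToContinuum.BoseEinsteinCondensation.Theorems.BECCutLineWeakDisorderOccupationStability
import Summits.AtomisticToContinuum.BoseEinsteinCondensation.Theorems.BECCutLineWeakDisorderGroundStateRigidityReduction
import Summits.AtomisticToContinuum.BoseEinsteinCondensation.Theorems.BECCutLineWeakDisorderGroundStateRigidityUniqueOfRigid
import Summits.AtomisticToContinuum.BoseEinsteinCondensation.Theorems.BECCutLineWeakDisorderWitnessTransferRatio
import Summits.AtomisticToContinuum.BoseEinsteinCondensation.Theorems.BECInsertionVarianceGroundStateAccessibleFKGroundState
import Literature.MathematicalPhysics.QuantumManyBody.SwapPurity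
import HarnessLib

/-!
# Crux `TwoReplicaTransienceBound` (stmt-AtomisticToContinuum-9687), line `late-core-split`:
# near-minimisers versus the Feynman–Kac ground state (tools for the stub-level summit certificate)

Support file (`--supports stmt-AtomisticToContinuum-9687`; registered toolbox stub
`stub_nearMinimiserCloseFKGroundState`; lead c22). Companion of
`…LateCoreSplitZeroModeSummitNecessity.lean`, which proves that the open core stub `Z = WitnessZeroMode`
of the held skeleton ALONE implies `HasGroundStateBEC` by name on bounded admissible potentials and is
there EQUIVALENT to item stmt-AtomisticToContinuum-0686. The three tools, all at ONE fixed box: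

* `sqrt_occupation_le_of_continuous` — occupation stability (`occupationStability_proof`, item 9074)
  against a CONTINUOUS reference wave function that need not be a trial state (same Minkowski argument):
  `occ(u,Ψ)^{1/2} ≤ occ(u,Φ)^{1/2} + (n+1)^{1/2} ‖Ψ − cΦ‖₂`;
* `occupation_constMode_ofReal` — for a continuous nonnegative Dirichlet `F`, the flat-mode occupation is
  `(n+1) · L⁻³ ∫ s_F(Y)² dY`, `s_F(Y) = ∫ F(x, Y) dx`;
* `nearMinimiser_close_fkGroundState` (= registered stub `stub_nearMinimiserCloseFKGroundState`) — for
  bounded `v`, every `δ`-near-minimising trial state is `η`-close in `L²`, up to a constant phase, to the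
  Feynman–Kac ground state `Ψ₀` (`IsGroundStateFK`): `Ψ₀` is THE ground state of the closed form
  (`isGroundState_fkGroundState_of_bounded`, `IsGroundStateFK.eq_fkGroundState`), hence the `L²`-limit of
  near-minimising trial states (`GroundStateRigidity.exists_trialState_near`), and Perron–Frobenius
  rigidity (`GroundStateRigidity.rigid_of_bounded`) ties every near-minimiser to those.

## References

* E. H. Lieb, R. Seiringer, J. P. Solovej, J. Yngvason, *The Mathematics of the Bose Gas and its
  Condensation* (2005), §1.2 (1.17)–(1.19). [LSSY2005]
* M. Reed, B. Simon, *Methods of Modern Mathematical Physics IV* (1978), §XIII.12 Thms XIII.46–47.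
  [ReedSimonIV1978]
-/

noncomputable section

namespace Summit.AtomisticToContinuum.BoseEinsteinCondensation.Cruxes.TwoReplicaTransienceBound.LateCoreSplit

open MeasureTheory Filter Set
open scoped ENNReal NNReal Topology ComplexConjugate
open Literature.MathematicalPhysics.QuantumManyBody
open Literature.MathematicalPhysics.QuantumManyBody.BoseGas
open Summit.AtomisticToContinuum.BoseEinsteinCondensation.Theses
open Summit.AtomisticToContinuum.BoseEinsteinCondensation.Theses.BECCutLineWeakDisorder
open Summit.AtomisticToContinuum.BoseEinsteinCondensation.Theorems
open Summit.AtomisticToContinuum.BoseEinsteinCondensation.Theorems.CutLineWitness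
open Summit.AtomisticToContinuum.BoseEinsteinCondensation.Theorems.OccupationStability
/-! ### Occupation stability against a continuous reference -/

/-- **Occupation stability against a continuous reference.** For a normalised a.e.-strongly measurable
mode `u`, continuous `Ψ, Φ : (ℝ³)^{n+1} → ℂ` and `|c| = 1`:
`occ(u,Ψ)^{1/2} ≤ occ(u,Φ)^{1/2} + (n+1)^{1/2} (∫ |Ψ - cΦ|²)^{1/2}` — the Minkowski argument of
`occupationStability_proof` (item stmt-AtomisticToContinuum-9074), which uses of the trial states only the
continuity of their wave functions. [cite: LSSY2005, §1.2 (1.17)] -/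
theorem sqrt_occupation_le_of_continuous {n : ℕ} {u : Space → ℂ} (hu : AEStronglyMeasurable u volume)
    (hu1 : ∫⁻ x, (‖u x‖₊ : ℝ≥0∞) ^ 2 = 1) {Ψ Φ : Config (n + 1) → ℂ} (hΨc : Continuous Ψ)
    (hΦc : Continuous Φ) {c : ℂ} (hc : ‖c‖ = 1) :
    occupation (n + 1) u Ψ ^ (1 / 2 : ℝ) ≤
      occupation (n + 1) u Φ ^ (1 / 2 : ℝ) +
        ((n + 1 : ℕ) : ℝ≥0∞) ^ (1 / 2 : ℝ) * (∫⁻ X, (‖Ψ X - c * Φ X‖₊ : ℝ≥0∞) ^ 2) ^ (1 / 2 : ℝ) := by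
  have hocc : ∀ Θ : Config (n + 1) → ℂ, occupation (n + 1) u Θ =
      (n + 1 : ℝ≥0∞) * ∫⁻ Y : Config n,
        (‖∫ x, conj (u x) * Θ (Matrix.vecCons x Y)‖₊ : ℝ≥0∞) ^ 2 := fun Θ => rfl
  have hN : ((n + 1 : ℕ) : ℝ≥0∞) = (n + 1 : ℝ≥0∞) := by push_cast; rfl
  have hDm : Measurable fun X => Ψ X - c * Φ X := (hΨc.sub (continuous_const.mul hΦc)).measurable
  -- Tonelli in `X = x :: Y`
  have hTon : ∫⁻ X, (‖Ψ X - c * Φ X‖₊ : ℝ≥0∞) ^ 2 =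
      ∫⁻ Y : Config n, ∫⁻ x : Space,
        (‖Ψ (Matrix.vecCons x Y) - c * Φ (Matrix.vecCons x Y)‖₊ : ℝ≥0∞) ^ 2 :=
    (lintegral_lintegral_sq_nnnorm_vecCons hDm).symm
  -- Minkowski in `L²(dY)` on top of the pointwise slice bound
  have key : (∫⁻ Y : Config n,
        (‖∫ x, conj (u x) * Ψ (Matrix.vecCons x Y)‖₊ : ℝ≥0∞) ^ 2) ^ (1 / 2 : ℝ) ≤
      (∫⁻ Y : Config n,
          (‖∫ x, conj (u x) * Φ (Matrix.vecCons x Y)‖₊ : ℝ≥0∞) ^ 2) ^ (1 / 2 : ℝ) +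
        (∫⁻ Y : Config n, ∫⁻ x : Space,
          (‖Ψ (Matrix.vecCons x Y) - c * Φ (Matrix.vecCons x Y)‖₊ : ℝ≥0∞) ^ 2) ^
            (1 / 2 : ℝ) := by
    set f : Config n → ℝ≥0∞ := fun Y =>
      (‖∫ x, conj (u x) * Φ (Matrix.vecCons x Y)‖₊ : ℝ≥0∞) with hf
    set g : Config n → ℝ≥0∞ := fun Y => (∫⁻ x : Space,
      (‖Ψ (Matrix.vecCons x Y) - c * Φ (Matrix.vecCons x Y)‖₊ : ℝ≥0∞) ^ 2) ^ (1 / 2 : ℝ)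
      with hg
    have hfm : AEMeasurable f volume :=
      (aestronglyMeasurable_pairing hu hΦc).aemeasurable.nnnorm.coe_nnreal_ennreal
    have hgm : AEMeasurable g volume :=
      ((measurable_lintegral_sq_nnnorm_vecCons hDm).pow_const _).aemeasurable
    have hg2 : ∀ Y, g Y ^ 2 = ∫⁻ x : Space,
        (‖Ψ (Matrix.vecCons x Y) - c * Φ (Matrix.vecCons x Y)‖₊ : ℝ≥0∞) ^ 2 := fun Y => by
      rw [hg, ← ENNReal.rpow_two, ← ENNReal.rpow_mul]
      norm_num
    have hmink := ENNReal.lintegral_Lp_add_le (μ := (volume : Measure (Config n))) hfm hgm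
      (by norm_num : (1 : ℝ) ≤ 2)
    simp only [Pi.add_apply, ENNReal.rpow_two, hg2] at hmink
    refine le_trans ?_ hmink
    gcongr with Y
    exact nnnorm_integral_conj_mul_le_add hu hu1
      (hΨc.comp (continuous_id.matrixVecCons continuous_const)).aestronglyMeasurable
      (hΦc.comp (continuous_id.matrixVecCons continuous_const)).aestronglyMeasurable hc
  rw [hocc, hocc, hN, hTon, ENNReal.mul_rpow_of_nonneg _ _ (by norm_num : (0 : ℝ) ≤ 1 / 2),
    ENNReal.mul_rpow_of_nonneg _ _ (by norm_num : (0 : ℝ) ≤ 1 / 2), ← mul_add]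
  exact mul_le_mul_right key _

/-! ### The flat-mode occupation of a nonnegative wave function -/

/-- **Flat-mode occupation of a nonnegative function is the slice-mass square.** For `L > 0` and a
continuous `F : (ℝ³)^{n+1} → ℝ`, `F ≥ 0`, vanishing off `Λ_L^{n+1}`, the occupation of the flat mode
`φ₀ = L^{-3/2} 1_Λ` in (the complexification of) `F` is `(n+1) · L⁻³ · ∫ (∫ F(x, Y) dx)² dY`
(`⟨φ₀, F(·,Y)⟩ = L^{-3/2} s_F(Y)` slice by slice). [cite: LSSY2005, §1.2 (1.17)] -/
theorem occupation_constMode_ofReal {n : ℕ} {L : ℝ} (hL : 0 < L) {F : Config (n + 1) → ℝ}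
    (hFc : Continuous F) (hF0 : ∀ X, X ∉ boxN (n + 1) L → F X = 0) (hFnn : ∀ X, 0 ≤ F X) :
    occupation (n + 1) ((box L).indicator fun _ => ((Real.sqrt (L ^ 3))⁻¹ : ℂ)) (fun X => (F X : ℂ)) =
      (n + 1 : ℝ≥0∞) * ((ENNReal.ofReal (L ^ 3))⁻¹ *
        ∫⁻ Y : Config n, (∫⁻ x, (‖F (Matrix.vecCons x Y)‖₊ : ℝ≥0∞)) ^ 2) := by
  have hL3 : 0 < L ^ 3 := by positivity
  set bx := box L with hbx
  set φ₀ : Space → ℂ := bx.indicator fun _ => ((Real.sqrt (L ^ 3))⁻¹ : ℂ) with hφ₀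
  have hocc : occupation (n + 1) φ₀ (fun X => (F X : ℂ)) =
      (n + 1 : ℝ≥0∞) * ∫⁻ Y : Config n,
        (‖∫ x, conj (φ₀ x) * (F (Matrix.vecCons x Y) : ℂ)‖₊ : ℝ≥0∞) ^ 2 := rfl
  rw [hocc, ← lintegral_const_mul' _ _ (ENNReal.inv_ne_top.2 (ENNReal.ofReal_pos.2 hL3).ne')]
  congr 1
  refine lintegral_congr fun Y => ?_
  have cv : Continuous fun x : Space => (Matrix.vecCons x Y : Config (n + 1)) :=
    continuous_id.matrixVecCons continuous_const
  have h0 : ∀ x ∉ bx, F (Matrix.vecCons x Y) = 0 :=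
    fun x hx => hF0 _ fun h => hx (vecCons_mem_boxN_iff.1 h).1
  have hint : Integrable (fun x => F (Matrix.vecCons x Y)) volume := by
    refine (hFc.comp cv).integrable_of_hasCompactSupport ?_
    exact HasCompactSupport.intro (isCompact_closedBall (0 : Space) (3 * |L|))
      fun x hx => h0 x fun hb => hx (mem_closedBall_zero_iff.2 (norm_le_of_mem_box hb))
  have hnormF : ∀ x, ‖F (Matrix.vecCons x Y)‖ = F (Matrix.vecCons x Y) :=
    fun x => Real.norm_of_nonneg (hFnn _)
  have hsn : 0 ≤ ∫ x, ‖F (Matrix.vecCons x Y)‖ := integral_nonneg fun x => norm_nonneg _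
  have he : ∫ x, conj (φ₀ x) * (F (Matrix.vecCons x Y) : ℂ) =
      ((Real.sqrt (L ^ 3))⁻¹ : ℝ) * ((∫ x, ‖F (Matrix.vecCons x Y)‖ : ℝ) : ℂ) := by
    rw [← integral_complex_ofReal, ← integral_const_mul]
    refine integral_congr_ae (.of_forall fun x => ?_)
    by_cases hx : x ∈ bx
    · simp only [hφ₀, Set.indicator_of_mem hx, map_inv₀, Complex.conj_ofReal, Complex.ofReal_inv,
        hnormF x]
    · simp [hφ₀, Set.indicator_of_notMem hx, h0 x hx]
  have hlhs : ((‖∫ x, conj (φ₀ x) * (F (Matrix.vecCons x Y) : ℂ)‖₊ : ℝ≥0∞)) =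
      ‖∫ x, conj (φ₀ x) * (F (Matrix.vecCons x Y) : ℂ)‖ₑ := rfl
  have hrhs : (∫⁻ x, (‖F (Matrix.vecCons x Y)‖₊ : ℝ≥0∞)) = ∫⁻ x, ‖F (Matrix.vecCons x Y)‖ₑ := rfl
  rw [hlhs, hrhs, he, enorm_mul, mul_pow, ← ofReal_norm, ← ofReal_norm, Complex.norm_real,
    Complex.norm_real, Real.norm_of_nonneg hsn, Real.norm_of_nonneg (by positivity),
    ofReal_integral_norm_eq_lintegral_enorm hint, ← ENNReal.ofReal_pow (by positivity), inv_pow,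
    Real.sq_sqrt hL3.le, ENNReal.ofReal_inv_of_pos hL3]

/-! ### Near-minimisers are close to the Feynman–Kac ground state (bounded potentials) -/

/-- **Near-minimisers are `L²`-close to the Feynman–Kac ground state, up to a phase** (bounded pair
potentials, one fixed box). For measurable `v ≤ C`, `N ≥ 1`, `L > 0`, a Feynman–Kac ground state `Ψ₀`
(`IsGroundStateFK v L Ψ₀`) and `η > 0` there is `δ > 0` such that every trial state of energy
`≤ E₀(N, L) + δ` satisfies `∫ |Ψ₀ - cΨ|² ≤ η` for some unit `c`: `Ψ₀` is THE ground state of the closed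
form (`isGroundState_fkGroundState_of_bounded`, `IsGroundStateFK.eq_fkGroundState`), so some
`δ`-near-minimising trial state `T` is `η/4`-close to it (`GroundStateRigidity.exists_trialState_near`),
and Perron–Frobenius rigidity (`GroundStateRigidity.rigid_of_bounded`) puts every `δ`-near-minimiser
`η/4`-close to `T` up to a phase. [cite: ReedSimonIV1978, §XIII.12 Thms XIII.46–XIII.47] -/
theorem nearMinimiser_close_fkGroundState {N : ℕ} {v : ℝ → ℝ≥0∞} (hv : Measurable v) {C : ℝ≥0}
    (hC : ∀ r, v r ≤ C) {L : ℝ} (hL : 0 < L) (hN : 1 ≤ N) {Ψ₀ : Config N → ℝ}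
    (h₀ : IsGroundStateFK v L Ψ₀) {η : ℝ} (hη : 0 < η) :
    ∃ δ : ℝ≥0∞, 0 < δ ∧ ∀ Ψ : TrialState N L, energy v Ψ ≤ groundStateEnergy v N L + δ →
      ∃ c : ℂ, ‖c‖ = 1 ∧
        ∫⁻ X, (‖(Ψ₀ X : ℂ) - c * Ψ.ψ X‖₊ : ℝ≥0∞) ^ 2 ≤ ENNReal.ofReal η := by
  -- `Ψ₀` is the canonical FK ground state, hence a ground state of the closed form
  have hGS : IsGroundState v L (fun X => (Ψ₀ X : ℂ)) := by
    have h := (BECInsertionVariance.isGroundState_fkGroundState_of_bounded hN hL hv ⟨C, hC⟩).1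
    rwa [← h₀.eq_fkGroundState] at h
  obtain ⟨δ, hδ, hrig⟩ :=
    GroundStateRigidity.rigid_of_bounded N v C L hN hv hC hL (η / 4) (by positivity)
  obtain ⟨T, hTE, hTclose⟩ := GroundStateRigidity.exists_trialState_near hGS hδ
    (ε := ENNReal.ofReal (η / 4)) (ENNReal.ofReal_pos.2 (by positivity))
  refine ⟨δ, hδ, fun Ψ hΨE => ?_⟩
  obtain ⟨c, hc, hcl⟩ := hrig T Ψ hTE hΨE
  refine ⟨c, hc, ?_⟩
  -- pointwise: `Ψ₀ - cΨ = (Ψ₀ - T) + (T - cΨ)`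
  have hpt : ∀ X, (‖(Ψ₀ X : ℂ) - c * Ψ.ψ X‖₊ : ℝ≥0∞) ^ 2 ≤
      2 * (‖T.ψ X - (Ψ₀ X : ℂ)‖₊ : ℝ≥0∞) ^ 2 + 2 * (‖T.ψ X - c * Ψ.ψ X‖₊ : ℝ≥0∞) ^ 2 := by
    intro X
    have h := GroundStateRigidity.coe_nnnorm_add_sq_le (-(T.ψ X - (Ψ₀ X : ℂ))) (T.ψ X - c * Ψ.ψ X)
    rwa [nnnorm_neg, show -(T.ψ X - (Ψ₀ X : ℂ)) + (T.ψ X - c * Ψ.ψ X) = (Ψ₀ X : ℂ) - c * Ψ.ψ X by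
      ring] at h
  have hΨ₀m : Measurable fun X => (Ψ₀ X : ℂ) := Complex.measurable_ofReal.comp h₀.measurable
  have hTm : Measurable T.ψ := T.contDiff.continuous.measurable
  have hΨm : Measurable Ψ.ψ := Ψ.contDiff.continuous.measurable
  have hm1 : Measurable fun X => (‖T.ψ X - (Ψ₀ X : ℂ)‖₊ : ℝ≥0∞) ^ 2 :=
    (hTm.sub hΨ₀m).nnnorm.coe_nnreal_ennreal.pow_const 2
  have hm2 : Measurable fun X => (‖T.ψ X - c * Ψ.ψ X‖₊ : ℝ≥0∞) ^ 2 :=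
    (hTm.sub (measurable_const.mul hΨm)).nnnorm.coe_nnreal_ennreal.pow_const 2
  have h4 : (2 : ℝ≥0∞) * ENNReal.ofReal (η / 4) + 2 * ENNReal.ofReal (η / 4) = ENNReal.ofReal η := by
    rw [← ENNReal.ofReal_ofNat 2, ← ENNReal.ofReal_mul (by norm_num),
      ← ENNReal.ofReal_add (by positivity) (by positivity)]
    congr 1
    ring
  calc ∫⁻ X, (‖(Ψ₀ X : ℂ) - c * Ψ.ψ X‖₊ : ℝ≥0∞) ^ 2
      ≤ ∫⁻ X, (2 * (‖T.ψ X - (Ψ₀ X : ℂ)‖₊ : ℝ≥0∞) ^ 2 +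
          2 * (‖T.ψ X - c * Ψ.ψ X‖₊ : ℝ≥0∞) ^ 2) := lintegral_mono hpt
    _ = (2 * ∫⁻ X, (‖T.ψ X - (Ψ₀ X : ℂ)‖₊ : ℝ≥0∞) ^ 2) +
          2 * ∫⁻ X, (‖T.ψ X - c * Ψ.ψ X‖₊ : ℝ≥0∞) ^ 2 := by
        rw [lintegral_add_left (μ := volume) (hm1.const_mul 2),
          lintegral_const_mul (μ := volume) _ hm1, lintegral_const_mul (μ := volume) _ hm2]
    _ ≤ 2 * ENNReal.ofReal (η / 4) + 2 * ENNReal.ofReal (η / 4) :=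
        add_le_add (mul_le_mul_right hTclose 2) (mul_le_mul_right hcl 2)
    _ = ENNReal.ofReal η := h4

/-- **Registered toolbox stub `stub_nearMinimiserCloseFKGroundState`** (verbatim registered signature;
= `nearMinimiser_close_fkGroundState` with explicit binders): near-minimisers are `L²`-close to the
Feynman–Kac ground state up to a phase, for bounded pair potentials at a fixed box.
[cite: ReedSimonIV1978, §XIII.12 Thms XIII.46–XIII.47] -/
theorem stub_nearMinimiserCloseFKGroundState : ∀ (N : ℕ) (v : ℝ → ENNReal) (C : NNReal) (L : ℝ) (Ψ₀ : Literature.MathematicalPhysics.QuantumManyBody.BoseGas.Config N → ℝ) (η : ℝ), Measurable v → (∀ r : ℝ, v r ≤ C) → 0 < L → 1 ≤ N → Literature.MathematicalPhysics.QuantumManyBody.BoseGas.IsGroundStateFK v L Ψ₀ → 0 < η → ∃ δ : ENNReal, 0 < δ ∧ ∀ Ψ : Literature.MathematicalPhysics.QuantumManyBody.BoseGas.TrialState N L, Literature.MathematicalPhysics.QuantumManyBody.BoseGas.energy v Ψ ≤ Literature.MathematicalPhysics.QuantumManyBody.BoseGas.groundStateEnergy v N L + δ → ∃ c : ℂ,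 ‖c‖ = 1 ∧ ∫⁻ X, (‖(Ψ₀ X : ℂ) - c * Ψ.ψ X‖₊ : ENNReal) ^ 2 ≤ ENNReal.ofReal η :=
  fun _ _ _ _ _ _ hv hC hL hN h₀ hη => nearMinimiser_close_fkGroundState hv hC hL hN h₀ hη

end Summit.AtomisticToContinuum.BoseEinsteinCondensation.Cruxes.TwoReplicaTransienceBound.LateCoreSplit

end
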